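import Summits.QuantumFields.YangMills.Theorems.FluctuationComparisonRegPrIntLWregAssembly
import Summits.QuantumFields.YangMills.Theorems.FluctuationComparisonRegPrIntLS2BetaResidualGaugeOrbit
import Summits.QuantumFields.YangMills.Theorems.FluctuationComparisonRegPrIntLS2BetaResidualSubgroup
import Mathlib.Topology.Order.Compact
import HarnessLib

/-!
# (RG-K ⊕ WREG) FIBRE TRANSPORT: EXW ∕ GAP♯ in the FINE variables of the WREG chart data — the LIMIT-INST rows `hO0 hmin ha0 hg hg0 hgpos hgrow`

Definition-free helper for LINE g18-1 `Cruxes/FluctuationComparisonRegPrIntL/Lines/semiclassical_s2beta.lean` (crux `stmt-QuantumFields-20520`, row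
LAPLACE ∕ LIMIT; seam (e) of w5-20520 g13's V8-DOCKING-DESIGN memo, evidence n=56: «EXW∕GAP♯ in FINE variables — needs `WindowChart.Φ` inj∕surj rows
from the WREG port»).  ✓`…S2BetaLaplaceInst.laplaceLimit_of_charts` (w5-20520 g13) reads the minimiser and the growth function in the fibre variable
`z ∈ SU(2)^{bonds of run K}` THROUGH the chart `c.Φ (V, ·)`: rows `hO0 : c.Φ (V, σ 0) ∈ Sf`, `hmin : wilsonAction4 (c.Φ (V, σ 0)) = m`,
`ha0 : 0 < c.jac (V, σ 0)`, `hg ∕ hg0 ∕ hgpos ∕ hgrow` for a growth function `g` on the carrier `Xc`.  The organs EXW (`WindowExactness`) and GAP♯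
(`UniformFibreGapOrbit`) speak instead of the FIBRE `fibre F ℰp J K hJK V ∩ histGood` and of the squared distance to the RESIDUAL-GAUGE ORBIT of a
minimiser `U₀`.  The WREG port's chart data (✓`…WregAssembly.ChartData`, fields `recog` ∕ `charted`; F2 = px11 g8's `…WregFibredChart(Reg)` ∕
`…WregDescendChart`, F5 = px7 g8) already carry the two facts that bridge them:

* §1 CHART-DATA FIBRE LETTERS — `jac_ne_zero_and_Φ_eq_self` (SELF-RECOGNITION: a small-field history `U₀` in the fibre over `V` is its own chart value,
  `D.jac (V, U₀) ≠ 0 ∧ D.Φ (V, U₀) = U₀` — `D.recog` at the pivot data of `U₀` itself), `descendTo_Φ_of_charted` (the chart value lies in the fibre),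
  `extend_pivots_Φ_eq_self` (the chart value has `z`'s off-pivot coordinates, so resampling ITS pivots by `z`'s gives back `z`), and
  ★`exists_pivotAct_eq_of_Φ_eq_gaugeAct` — if `D.Φ (V, z) = w • U₀` for a residual `w` then `z` IS in the `pivotAct`-orbit of `U₀`: NO equivariance of
  the chart is needed for LIMIT-INST's `hgpos`;
* §2 `continuous_iInf_orbitDistSq` — the residual-orbit distance `U ↦ ⨅_w Σ_ℓ dist1 (U ℓ · (w • U₀)ℓ⁻¹)²` is continuous (compact group, joint continuity,
  `IsCompact.continuous_sInf`);
* §3 ★★ `limitInst_exw_gap_rows` — from EXW's and GAP♯'s conclusions AT ONE WINDOW DATUM (their v7 bodies, instantiated, as hypotheses), a carrier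
  `Xc` inside the charted window graph on which `D.Φ (V, ·)` is continuous (CHART∞'s row), and `σ 0 := U₀`: the seven rows of LIMIT-INST VERBATIM for
  the chart `D.Φ ∕ D.jac` (`= (WindowChart.ofChartData D …).Φ ∕ .jac` by `rfl`), `Sf := histGood`, `act := pivotAct F hJK (iterCentralBond (K−J))`,
  `g z := μ′ · ⨅_w Σ_ℓ dist1 (D.Φ (V,z) ℓ · (w • U₀)ℓ⁻¹)²`.

DESIGN NOTE (memo seam (d)): these rows exist only for a chart that carries `recog` ∕ `charted` — a `ChartData`, or a `WindowChart` exported together with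
them; a bare `∃ c : WindowChart` forgets them.

HONEST: bookkeeping over landed letters; this file proves NO stub of the line — EXW, GAP♯, LAPLACE (CHART∞ ∕ LIMIT ∕ KNIT ∕ DECAY), H4ᶜ, LFR♯ᶜ, S2β and
crux 20520 stay OPEN; rung R3 (YM₃ on T³) is NOT d = 4, NOT infinite volume, NOT a mass gap, NOT Clay; the Yang–Mills mass gap is NOT proved.
-/

noncomputable section

open MeasureTheory Filter Topology Set Function
open scoped NNReal
open Literature.MathematicalPhysics.QuantumFieldTheory.Balaban1983to89
open Literature.MathematicalPhysics.QuantumFieldTheory.Balaban1983to89.T3ContinuumYM3Torus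
open Literature.MathematicalPhysics.QuantumFieldTheory.Balaban1983to89.T3UnitLawDensityEML
open Literature.MathematicalPhysics.QuantumFieldTheory.Balaban1983to89.T3UnitScaleTilt
open Literature.MathematicalPhysics.QuantumFieldTheory.Balaban1983to89.T3TiltDescent
open Literature.MathematicalPhysics.QuantumFieldTheory.Balaban1983to89.T3ConstrainedMinimiser (fibre)
open Literature.MathematicalPhysics.QuantumFieldTheory.Balaban1983to89.T4Continuum
open scoped Literature.MathematicalPhysics.QuantumFieldTheory.Balaban1983to89.T3OrbitAverage
open Summit.QuantumFields.YangMills.Theorems.FluctuationComparisonRegPrIntLWregChain (iterCentralBond iterCentralBond_injective chainWindow)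
open Summit.QuantumFields.YangMills.Theorems.FluctuationComparisonRegPrIntLWregAssembly (ChartData histGood_subset_charted)
open Summit.QuantumFields.YangMills.Theorems.FluctuationComparisonRegPrIntLS2BetaResidualGauge
open Summit.QuantumFields.YangMills.Theorems.FluctuationComparisonRegPrIntLS2BetaResidualGaugeOrbit
open Summit.QuantumFields.YangMills.Theorems.FluctuationComparisonRegPrIntLS2BetaResidualSubgroup

namespace Summit.QuantumFields.YangMills.Theorems.FluctuationComparisonRegPrIntLS2BetaFibreTransport

/-! ## §1 Chart-data fibre letters: self-recognition, the fibre row, pivot resampling, and the orbit row -/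

section Letters

variable {F : T3Family} {J K : ℕ} {hJK : J ≤ K} {α : ℝ} {θ : ℕ → ℝ}
  {O : Set (GaugeField (F.P J) 0 (Matrix.specialUnitaryGroup (Fin 2) ℂ))}

/-- Resampling the pivot entries of a field by ITS OWN pivot entries does nothing. [cite: Balaban1987RG1, (0.4) p.253] -/
theorem extend_iterCentralBond_apply_self (z : GaugeField (F.P K) 0 (Matrix.specialUnitaryGroup (Fin 2) ℂ)) :
    Function.extend (iterCentralBond (P := F.P K) (K - J)) (fun c => z (iterCentralBond (P := F.P K) (K - J) c)) z = z := by
  classical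
  funext b
  by_cases hb : ∃ c, iterCentralBond (P := F.P K) (K - J) c = b
  · obtain ⟨c, rfl⟩ := hb
    have hk : K - J ≤ (F.P K).m + (F.P K).K := by
      show K - J ≤ F.m + K
      omega
    rw [(iterCentralBond_injective (P := F.P K) hk).extend_apply]
  · rw [Function.extend_apply' _ _ _ hb]

/-- ★ **SELF-RECOGNITION**: a small-field history `U₀ ∈ histGood` in the fibre over `V` is its own chart value and a live point of the Jacobian —
`D.jac (V, U₀) ≠ 0 ∧ D.Φ (V, U₀) = U₀` (`D.recog` at the pivot data `U₀ ∘ βₖ` of `U₀` itself; the pivots of a small history are charted,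
✓`histGood_subset_charted`).  This is the «surjectivity» half of the WREG chart on the fibre: EVERY point of `fibre V ∩ histGood` is a chart value.
[cite: Balaban1987RG1, (0.4) p.253, (2.4) p.266 and (2.10) p.267; Balaban1985UV3, (7) p.257] -/
theorem jac_ne_zero_and_Φ_eq_self (D : ChartData F hJK α (histGood F ℰp θ K J) O) (hθ0 : ∀ i, 0 ≤ θ i)
    (hθα : ∀ i, (((((F.P K).d + 2) * (F.P K).L : ℕ) : ℝ) ^ 2 / 4) * θ i ≤ α)
    {V : GaugeField (F.P J) 0 (Matrix.specialUnitaryGroup (Fin 2) ℂ)} {U₀ : GaugeField (F.P K) 0 (Matrix.specialUnitaryGroup (Fin 2) ℂ)}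
    (hU₀f : U₀ ∈ fibre F ℰp J K hJK V) (hU₀h : U₀ ∈ histGood F ℰp θ K J) :
    D.jac (V, U₀) ≠ 0 ∧ D.Φ (V, U₀) = U₀ := by
  have hext := extend_iterCentralBond_apply_self (F := F) (J := J) (K := K) U₀
  have hwin : ∀ c, U₀ (iterCentralBond (P := F.P K) (K - J) c) ∈ chainWindow (N := 2) α (K - J) U₀ c :=
    histGood_subset_charted F hJK hθ0 hθα hU₀h
  have h := D.recog V U₀ (fun c => U₀ (iterCentralBond (P := F.P K) (K - J) c)) hwin (by rw [hext]; exact hU₀h)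
    (by rw [hext]; exact hU₀f)
  rw [hext] at h
  exact h

/-- **THE FIBRE ROW**: at a charted point the chart value descends to `V`, i.e. lies in the fibre over `V` (`D.charted` (iii)).
[cite: Balaban1987RG1, (2.4) p.266] -/
theorem descendTo_Φ_of_charted (D : ChartData F hJK α (histGood F ℰp θ K J) O)
    {V : GaugeField (F.P J) 0 (Matrix.specialUnitaryGroup (Fin 2) ℂ)} {z : GaugeField (F.P K) 0 (Matrix.specialUnitaryGroup (Fin 2) ℂ)}
    (hz : ∀ c, V (D.w c) ∈ D.T c z) : D.Φ (V, z) ∈ fibre F ℰp J K hJK V :=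
  (D.charted V z hz).2.2

/-- **PIVOT RESAMPLING**: the chart value keeps `z`'s off-pivot coordinates (`D.charted` (i)), so resampling the pivots of `D.Φ (V, z)` by those of `z`
gives back `z` — the «injectivity modulo pivots» of the WREG chart. [cite: Balaban1987RG1, (0.4) p.253 and (2.10) p.267] -/
theorem extend_pivots_Φ_eq_self (D : ChartData F hJK α (histGood F ℰp θ K J) O)
    {V : GaugeField (F.P J) 0 (Matrix.specialUnitaryGroup (Fin 2) ℂ)} {z : GaugeField (F.P K) 0 (Matrix.specialUnitaryGroup (Fin 2) ℂ)}
    (hz : ∀ c, V (D.w c) ∈ D.T c z) :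
    Function.extend (iterCentralBond (P := F.P K) (K - J)) (fun c => z (iterCentralBond (P := F.P K) (K - J) c)) (D.Φ (V, z)) = z := by
  classical
  funext b
  by_cases hb : ∃ c, iterCentralBond (P := F.P K) (K - J) c = b
  · obtain ⟨c, rfl⟩ := hb
    have hk : K - J ≤ (F.P K).m + (F.P K).K := by
      show K - J ≤ F.m + K
      omega
    rw [(iterCentralBond_injective (P := F.P K) hk).extend_apply]
  · rw [Function.extend_apply' _ _ _ hb]
    exact (D.charted V z hz).1 b fun c hc => hb ⟨c, hc⟩

/-- Two charted points with the same chart value differ only on the pivots. [cite: Balaban1987RG1, (0.4) p.253 and (2.10) p.267] -/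
theorem eq_extend_pivots_of_Φ_eq (D : ChartData F hJK α (histGood F ℰp θ K J) O)
    {V : GaugeField (F.P J) 0 (Matrix.specialUnitaryGroup (Fin 2) ℂ)} {z z' : GaugeField (F.P K) 0 (Matrix.specialUnitaryGroup (Fin 2) ℂ)}
    (hz : ∀ c, V (D.w c) ∈ D.T c z) (hz' : ∀ c, V (D.w c) ∈ D.T c z') (h : D.Φ (V, z) = D.Φ (V, z')) :
    z' = Function.extend (iterCentralBond (P := F.P K) (K - J)) (fun c => z' (iterCentralBond (P := F.P K) (K - J) c)) z := by
  classical
  have hk : K - J ≤ (F.P K).m + (F.P K).K := by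
    show K - J ≤ F.m + K
    omega
  funext b
  by_cases hb : ∃ c, iterCentralBond (P := F.P K) (K - J) c = b
  · obtain ⟨c, rfl⟩ := hb
    rw [(iterCentralBond_injective (P := F.P K) hk).extend_apply]
  · rw [Function.extend_apply' _ _ _ hb, ← (D.charted V z' hz').1 b fun c hc => hb ⟨c, hc⟩,
      ← (D.charted V z hz).1 b fun c hc => hb ⟨c, hc⟩, h]

/-- ★ **THE ORBIT ROW (no equivariance needed)**: if the chart value at a charted point `z` is a RESIDUAL-GAUGE transform `w • U₀` of the base point,
then `z` itself is in the orbit of `U₀` under the enlarged action `pivotAct F hJK βₖ` of `↥(residualSubgroup F hJK) × SU(2)^{pivots}` — take the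
residual factor `w` and the pivot factor `h c := z (βₖ c) · U₀ (βₖ c)⁻¹`: off the pivots `pivotAct` reads `(w • U₀) b = D.Φ (V,z) b = z b`, on them
`h c · U₀ (βₖ c) = z (βₖ c)`.  Contrapositive = LIMIT-INST's `hgpos`. [cite: Balaban1985Variational, Thm 1 (8)-(10) p.279; Balaban1985Averaging, (8) p.19] -/
theorem exists_pivotAct_eq_of_Φ_eq_gaugeAct (D : ChartData F hJK α (histGood F ℰp θ K J) O)
    {V : GaugeField (F.P J) 0 (Matrix.specialUnitaryGroup (Fin 2) ℂ)} {z U₀ : GaugeField (F.P K) 0 (Matrix.specialUnitaryGroup (Fin 2) ℂ)}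
    (hz : ∀ c, V (D.w c) ∈ D.T c z) {w : Site (F.P K) 0 → Matrix.specialUnitaryGroup (Fin 2) ℂ}
    (hw : ∀ U : GaugeField (F.P K) 0 (Matrix.specialUnitaryGroup (Fin 2) ℂ),
      descendTo F ℰp J K hJK (GaugeField.gaugeAct w U) = descendTo F ℰp J K hJK U)
    (h : D.Φ (V, z) = GaugeField.gaugeAct w U₀) :
    ∃ k : ↥(residualSubgroup F hJK) × (PBond (F.P K) (K - J) → Matrix.specialUnitaryGroup (Fin 2) ℂ),
      pivotAct F hJK (iterCentralBond (P := F.P K) (K - J)) k U₀ = z := by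
  classical
  have hk : K - J ≤ (F.P K).m + (F.P K).K := by
    show K - J ≤ F.m + K
    omega
  refine ⟨(⟨w, hw⟩, fun c => z (iterCentralBond (P := F.P K) (K - J) c) * (U₀ (iterCentralBond (P := F.P K) (K - J) c))⁻¹), ?_⟩
  funext b
  by_cases hb : ∃ c, iterCentralBond (P := F.P K) (K - J) c = b
  · obtain ⟨c, rfl⟩ := hb
    rw [pivotAct_apply_pivot F hJK _ (iterCentralBond_injective (P := F.P K) hk)]
    show z (iterCentralBond (P := F.P K) (K - J) c) * (U₀ (iterCentralBond (P := F.P K) (K - J) c))⁻¹ *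
        U₀ (iterCentralBond (P := F.P K) (K - J) c) = z (iterCentralBond (P := F.P K) (K - J) c)
    rw [inv_mul_cancel_right]
  · rw [pivotAct_apply_of_not_mem_range F hJK _ _ _ hb]
    show GaugeField.gaugeAct w U₀ b = z b
    rw [← h]
    exact (D.charted V z hz).1 b fun c hc => hb ⟨c, hc⟩

end Letters

/-! ## §2 The residual-orbit distance is continuous in the field -/

section OrbitDistance

variable (F : T3Family) {J K : ℕ} (hJK : J ≤ K)

/-- Joint continuity of `(U, w) ↦ Σ_ℓ dist1 (U ℓ · (w • U₀)ℓ⁻¹)²` on fields × the residual set. [cite: Balaban1985Variational, Thm 1 (8) p.279] -/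
theorem continuous_orbitDistSq₂ (U₀ : GaugeField (F.P K) 0 (Matrix.specialUnitaryGroup (Fin 2) ℂ)) :
    Continuous fun p : GaugeField (F.P K) 0 (Matrix.specialUnitaryGroup (Fin 2) ℂ) ×
        {w : Site (F.P K) 0 → Matrix.specialUnitaryGroup (Fin 2) ℂ |
          ∀ U : GaugeField (F.P K) 0 (Matrix.specialUnitaryGroup (Fin 2) ℂ),
            descendTo F ℰp J K hJK (GaugeField.gaugeAct w U) = descendTo F ℰp J K hJK U} =>
      ∑ ℓ : PBond (F.P K) 0,
        dist1 (p.1 ℓ * ((GaugeField.gaugeAct (p.2 : Site (F.P K) 0 → Matrix.specialUnitaryGroup (Fin 2) ℂ) U₀) ℓ)⁻¹) ^ 2 := by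
  refine continuous_finsetSum _ fun ℓ _ => ?_
  have hdist : Continuous (dist1 : Matrix.specialUnitaryGroup (Fin 2) ℂ → ℝ) :=
    UnitaryModel.continuous_opDist1.comp (Literature.MathematicalPhysics.QuantumLattice.continuous_fundamentalRep (Fin 2))
  refine (hdist.comp ?_).pow 2
  have h1 : Continuous fun p : GaugeField (F.P K) 0 (Matrix.specialUnitaryGroup (Fin 2) ℂ) ×
      {w : Site (F.P K) 0 → Matrix.specialUnitaryGroup (Fin 2) ℂ |
        ∀ U : GaugeField (F.P K) 0 (Matrix.specialUnitaryGroup (Fin 2) ℂ),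
          descendTo F ℰp J K hJK (GaugeField.gaugeAct w U) = descendTo F ℰp J K hJK U} => p.1 ℓ :=
    (continuous_apply ℓ).comp continuous_fst
  have h2 : Continuous fun p : GaugeField (F.P K) 0 (Matrix.specialUnitaryGroup (Fin 2) ℂ) ×
      {w : Site (F.P K) 0 → Matrix.specialUnitaryGroup (Fin 2) ℂ |
        ∀ U : GaugeField (F.P K) 0 (Matrix.specialUnitaryGroup (Fin 2) ℂ),
          descendTo F ℰp J K hJK (GaugeField.gaugeAct w U) = descendTo F ℰp J K hJK U} =>
      (GaugeField.gaugeAct (p.2 : Site (F.P K) 0 → Matrix.specialUnitaryGroup (Fin 2) ℂ) U₀) ℓ := by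
    have hval : Continuous fun p : GaugeField (F.P K) 0 (Matrix.specialUnitaryGroup (Fin 2) ℂ) ×
        {w : Site (F.P K) 0 → Matrix.specialUnitaryGroup (Fin 2) ℂ |
          ∀ U : GaugeField (F.P K) 0 (Matrix.specialUnitaryGroup (Fin 2) ℂ),
            descendTo F ℰp J K hJK (GaugeField.gaugeAct w U) = descendTo F ℰp J K hJK U} =>
        (p.2 : Site (F.P K) 0 → Matrix.specialUnitaryGroup (Fin 2) ℂ) :=
      continuous_subtype_val.comp continuous_snd
    show Continuous fun p : GaugeField (F.P K) 0 (Matrix.specialUnitaryGroup (Fin 2) ℂ) ×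
        {w : Site (F.P K) 0 → Matrix.specialUnitaryGroup (Fin 2) ℂ |
          ∀ U : GaugeField (F.P K) 0 (Matrix.specialUnitaryGroup (Fin 2) ℂ),
            descendTo F ℰp J K hJK (GaugeField.gaugeAct w U) = descendTo F ℰp J K hJK U} =>
      (p.2 : Site (F.P K) 0 → Matrix.specialUnitaryGroup (Fin 2) ℂ) ℓ.src * U₀ ℓ *
        ((p.2 : Site (F.P K) 0 → Matrix.specialUnitaryGroup (Fin 2) ℂ) ℓ.tgt)⁻¹
    exact (((continuous_apply ℓ.src).comp hval).mul continuous_const).mul ((continuous_apply ℓ.tgt).comp hval).inv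
  exact h1.mul h2.inv

/-- ★ **THE RESIDUAL-ORBIT DISTANCE IS CONTINUOUS IN THE FIELD**: `U ↦ ⨅_{w residual} Σ_ℓ dist1 (U ℓ · (w • U₀)ℓ⁻¹)²` is continuous (the residual set is
compact, ✓`compactSpace_residualGauge`; the summand is jointly continuous; `IsCompact.continuous_sInf`). [cite: Balaban1985Variational, Thm 1 (8)-(10) p.279] -/
theorem continuous_iInf_orbitDistSq (U₀ : GaugeField (F.P K) 0 (Matrix.specialUnitaryGroup (Fin 2) ℂ)) :
    Continuous fun U : GaugeField (F.P K) 0 (Matrix.specialUnitaryGroup (Fin 2) ℂ) =>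
      ⨅ w : {w : Site (F.P K) 0 → Matrix.specialUnitaryGroup (Fin 2) ℂ |
          ∀ U : GaugeField (F.P K) 0 (Matrix.specialUnitaryGroup (Fin 2) ℂ),
            descendTo F ℰp J K hJK (GaugeField.gaugeAct w U) = descendTo F ℰp J K hJK U},
        ∑ ℓ : PBond (F.P K) 0,
          dist1 (U ℓ * ((GaugeField.gaugeAct (w : Site (F.P K) 0 → Matrix.specialUnitaryGroup (Fin 2) ℂ) U₀) ℓ)⁻¹) ^ 2 := by
  haveI := compactSpace_residualGauge F hJK
  have h := IsCompact.continuous_sInf (K := (univ : Set {w : Site (F.P K) 0 → Matrix.specialUnitaryGroup (Fin 2) ℂ |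
      ∀ U : GaugeField (F.P K) 0 (Matrix.specialUnitaryGroup (Fin 2) ℂ),
        descendTo F ℰp J K hJK (GaugeField.gaugeAct w U) = descendTo F ℰp J K hJK U}))
    (f := fun (U : GaugeField (F.P K) 0 (Matrix.specialUnitaryGroup (Fin 2) ℂ))
      (w : {w : Site (F.P K) 0 → Matrix.specialUnitaryGroup (Fin 2) ℂ |
        ∀ U : GaugeField (F.P K) 0 (Matrix.specialUnitaryGroup (Fin 2) ℂ),
          descendTo F ℰp J K hJK (GaugeField.gaugeAct w U) = descendTo F ℰp J K hJK U}) =>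
      ∑ ℓ : PBond (F.P K) 0,
        dist1 (U ℓ * ((GaugeField.gaugeAct (w : Site (F.P K) 0 → Matrix.specialUnitaryGroup (Fin 2) ℂ) U₀) ℓ)⁻¹) ^ 2)
    isCompact_univ (continuous_orbitDistSq₂ F hJK U₀)
  refine h.congr fun U => ?_
  rw [image_univ, sInf_range]

end OrbitDistance

/-! ## §3 The seven LIMIT-INST rows from EXW and GAP♯ at one datum, in fine variables -/

section Rows

variable (F : T3Family) {J K : ℕ} (hJK : J ≤ K)

/-- ★★ **EXW ∕ GAP♯ ⇒ LIMIT-INST's `hO0 hmin ha0 hg hg0 hgpos hgrow`, IN FINE VARIABLES — ABSTRACT CHART EDITION** (docks with ANY chart `(Φ, jac)` of the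
window fibration that exports three rows on the carrier `Xc`: OFF-PIVOT AGREEMENT `Φ (V, z) b = z b` off the pivots `βₖ`, the FIBRE ROW
`descendTo (Φ (V, z)) = V`, and SELF-RECOGNITION of the base point `jac (V, U₀) ≠ 0 ∧ Φ (V, U₀) = U₀` — e.g. w3-20520 g14's window chart of record
`exists_windowChart_cont` (its `charted` ∕ live ∕ recognition clauses on `Xc := {jac (V,·) ≠ 0}`) or any `ChartData` (§1)).  Further data: EXW's minimiser
`U₀` (`U₀ ∈ Sf`, `wilsonAction4 U₀ = m`); GAP♯'s conclusion at the datum with constant `μ′ > 0` over `fibre V ∩ Sf`; `ContinuousOn (Φ (V,·)) Xc` (CHART∞).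
Conclusion, with `σ 0 := U₀`, `g z := μ′ · ⨅_{w residual} Σ_ℓ dist1 (Φ (V,z) ℓ · (w • U₀)ℓ⁻¹)²` and the action `pivotAct F hJK (iterCentralBond (K−J))`: the
seven binder shapes of ✓`…S2BetaLaplaceInst.laplaceLimit_of_charts` (`c.Φ ↦ Φ`, `c.jac ↦ jac`).  `hgpos` needs NO equivariance of the chart: if the orbit
distance of `Φ (V, z)` vanishes then `Φ (V, z) = w • U₀` (✓`exists_eq_gaugeAct_of_iInf_le_zero`) and `z = pivotAct (w, h) U₀` with `h c := z (βₖc)·U₀(βₖc)⁻¹`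
by off-pivot agreement. [cite: Balaban1985Variational, Thm 1 (8)-(10) p.279 and (142) p.299; Balaban1987RG1, (0.4) p.253 and (2.10) p.267] -/
theorem limitInst_exw_gap_rows_of_chartRows
    (Φ : GaugeField (F.P J) 0 (Matrix.specialUnitaryGroup (Fin 2) ℂ) × GaugeField (F.P K) 0 (Matrix.specialUnitaryGroup (Fin 2) ℂ) →
      GaugeField (F.P K) 0 (Matrix.specialUnitaryGroup (Fin 2) ℂ))
    (jac : GaugeField (F.P J) 0 (Matrix.specialUnitaryGroup (Fin 2) ℂ) × GaugeField (F.P K) 0 (Matrix.specialUnitaryGroup (Fin 2) ℂ) → ℝ≥0)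
    {Sf : Set (GaugeField (F.P K) 0 (Matrix.specialUnitaryGroup (Fin 2) ℂ))}
    {V : GaugeField (F.P J) 0 (Matrix.specialUnitaryGroup (Fin 2) ℂ)} {m μ' : ℝ} (hμ' : 0 < μ')
    {U₀ : GaugeField (F.P K) 0 (Matrix.specialUnitaryGroup (Fin 2) ℂ)} (hU₀S : U₀ ∈ Sf) (hU₀m : wilsonAction4 U₀ = m)
    (hself : jac (V, U₀) ≠ 0 ∧ Φ (V, U₀) = U₀)
    (hgap : ∀ U ∈ fibre F ℰp J K hJK V, U ∈ Sf →
      μ' * ⨅ w : {w : Site (F.P K) 0 → Matrix.specialUnitaryGroup (Fin 2) ℂ |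
              ∀ U : GaugeField (F.P K) 0 (Matrix.specialUnitaryGroup (Fin 2) ℂ),
                descendTo F ℰp J K hJK (GaugeField.gaugeAct w U) = descendTo F ℰp J K hJK U},
            ∑ ℓ : PBond (F.P K) 0,
              dist1 (U ℓ * ((GaugeField.gaugeAct (w : Site (F.P K) 0 → Matrix.specialUnitaryGroup (Fin 2) ℂ) U₀) ℓ)⁻¹) ^ 2 ≤ wilsonAction4 U - m)
    {Xc : Set (GaugeField (F.P K) 0 (Matrix.specialUnitaryGroup (Fin 2) ℂ))}
    (hoff : ∀ z ∈ Xc, ∀ b, (∀ c, iterCentralBond (P := F.P K) (K - J) c ≠ b) → Φ (V, z) b = z b)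
    (hfib : ∀ z ∈ Xc, descendTo F ℰp J K hJK (Φ (V, z)) = V)
    (hΦc : ContinuousOn (fun z => Φ (V, z)) Xc) :
    Φ (V, U₀) ∈ Sf ∧ wilsonAction4 (Φ (V, U₀)) = m ∧ 0 < (jac (V, U₀) : ℝ) ∧
      ContinuousOn (fun z => μ' * ⨅ w : {w : Site (F.P K) 0 → Matrix.specialUnitaryGroup (Fin 2) ℂ |
              ∀ U : GaugeField (F.P K) 0 (Matrix.specialUnitaryGroup (Fin 2) ℂ),
                descendTo F ℰp J K hJK (GaugeField.gaugeAct w U) = descendTo F ℰp J K hJK U},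
            ∑ ℓ : PBond (F.P K) 0,
              dist1 (Φ (V, z) ℓ * ((GaugeField.gaugeAct (w : Site (F.P K) 0 → Matrix.specialUnitaryGroup (Fin 2) ℂ) U₀) ℓ)⁻¹) ^ 2) Xc ∧
      (∀ z ∈ Xc, 0 ≤ μ' * ⨅ w : {w : Site (F.P K) 0 → Matrix.specialUnitaryGroup (Fin 2) ℂ |
              ∀ U : GaugeField (F.P K) 0 (Matrix.specialUnitaryGroup (Fin 2) ℂ),
                descendTo F ℰp J K hJK (GaugeField.gaugeAct w U) = descendTo F ℰp J K hJK U},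
            ∑ ℓ : PBond (F.P K) 0,
              dist1 (Φ (V, z) ℓ * ((GaugeField.gaugeAct (w : Site (F.P K) 0 → Matrix.specialUnitaryGroup (Fin 2) ℂ) U₀) ℓ)⁻¹) ^ 2) ∧
      (∀ z ∈ Xc, (∀ k : ↥(residualSubgroup F hJK) × (PBond (F.P K) (K - J) → Matrix.specialUnitaryGroup (Fin 2) ℂ),
          pivotAct F hJK (iterCentralBond (P := F.P K) (K - J)) k U₀ ≠ z) →
        0 < μ' * ⨅ w : {w : Site (F.P K) 0 → Matrix.specialUnitaryGroup (Fin 2) ℂ |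
              ∀ U : GaugeField (F.P K) 0 (Matrix.specialUnitaryGroup (Fin 2) ℂ),
                descendTo F ℰp J K hJK (GaugeField.gaugeAct w U) = descendTo F ℰp J K hJK U},
            ∑ ℓ : PBond (F.P K) 0,
              dist1 (Φ (V, z) ℓ * ((GaugeField.gaugeAct (w : Site (F.P K) 0 → Matrix.specialUnitaryGroup (Fin 2) ℂ) U₀) ℓ)⁻¹) ^ 2) ∧
      (∀ z ∈ Xc, Φ (V, z) ∈ Sf →
        m + μ' * ⨅ w : {w : Site (F.P K) 0 → Matrix.specialUnitaryGroup (Fin 2) ℂ |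
              ∀ U : GaugeField (F.P K) 0 (Matrix.specialUnitaryGroup (Fin 2) ℂ),
                descendTo F ℰp J K hJK (GaugeField.gaugeAct w U) = descendTo F ℰp J K hJK U},
            ∑ ℓ : PBond (F.P K) 0,
              dist1 (Φ (V, z) ℓ * ((GaugeField.gaugeAct (w : Site (F.P K) 0 → Matrix.specialUnitaryGroup (Fin 2) ℂ) U₀) ℓ)⁻¹) ^ 2
          ≤ wilsonAction4 (Φ (V, z))) := by
  classical
  haveI := compactSpace_residualGauge F hJK
  haveI : Nonempty {w : Site (F.P K) 0 → Matrix.specialUnitaryGroup (Fin 2) ℂ |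
              ∀ U : GaugeField (F.P K) 0 (Matrix.specialUnitaryGroup (Fin 2) ℂ),
                descendTo F ℰp J K hJK (GaugeField.gaugeAct w U) = descendTo F ℰp J K hJK U} := ⟨⟨1, residual_one F hJK⟩⟩
  have hk : K - J ≤ (F.P K).m + (F.P K).K := by
    show K - J ≤ F.m + K
    omega
  -- nonnegativity of the orbit infimum at any field
  have hinf0 : ∀ U : GaugeField (F.P K) 0 (Matrix.specialUnitaryGroup (Fin 2) ℂ),
      0 ≤ ⨅ w : {w : Site (F.P K) 0 → Matrix.specialUnitaryGroup (Fin 2) ℂ |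
              ∀ U : GaugeField (F.P K) 0 (Matrix.specialUnitaryGroup (Fin 2) ℂ),
                descendTo F ℰp J K hJK (GaugeField.gaugeAct w U) = descendTo F ℰp J K hJK U},
        ∑ ℓ : PBond (F.P K) 0,
          dist1 (U ℓ * ((GaugeField.gaugeAct (w : Site (F.P K) 0 → Matrix.specialUnitaryGroup (Fin 2) ℂ) U₀) ℓ)⁻¹) ^ 2 :=
    fun U => le_ciInf fun w => Finset.sum_nonneg fun ℓ _ => sq_nonneg _
  obtain ⟨hjac, hΦ⟩ := hself
  refine ⟨by rw [hΦ]; exact hU₀S, by rw [hΦ]; exact hU₀m, ?_, ?_, fun z _ => mul_nonneg hμ'.le (hinf0 _), fun z hz hkz => ?_,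
    fun z hz hzS => ?_⟩
  · -- `ha0`
    exact NNReal.coe_pos.2 (pos_iff_ne_zero.2 hjac)
  · -- `hg`
    exact (continuous_const.mul (continuous_iInf_orbitDistSq F hJK U₀)).comp_continuousOn hΦc
  · -- `hgpos`: off the `pivotAct`-orbit of `U₀` the orbit distance of the chart value is positive
    refine mul_pos hμ' (lt_of_le_of_ne (hinf0 _) fun h0 => ?_)
    obtain ⟨w, hw, hwU⟩ := exists_eq_gaugeAct_of_iInf_le_zero F hJK (Φ (V, z)) U₀ (le_of_eq h0.symm)
    refine hkz (⟨w, hw⟩, fun c => z (iterCentralBond (P := F.P K) (K - J) c) * (U₀ (iterCentralBond (P := F.P K) (K - J) c))⁻¹) ?_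
    funext b
    by_cases hb : ∃ c, iterCentralBond (P := F.P K) (K - J) c = b
    · obtain ⟨c, rfl⟩ := hb
      rw [pivotAct_apply_pivot F hJK _ (iterCentralBond_injective (P := F.P K) hk)]
      show z (iterCentralBond (P := F.P K) (K - J) c) * (U₀ (iterCentralBond (P := F.P K) (K - J) c))⁻¹ *
          U₀ (iterCentralBond (P := F.P K) (K - J) c) = z (iterCentralBond (P := F.P K) (K - J) c)
      rw [inv_mul_cancel_right]
    · rw [pivotAct_apply_of_not_mem_range F hJK _ _ _ hb]
      show GaugeField.gaugeAct w U₀ b = z b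
      rw [← hwU]
      exact hoff z hz b fun c hc => hb ⟨c, hc⟩
  · -- `hgrow`: GAP♯ at the chart value, which lies in the fibre
    have h := hgap (Φ (V, z)) (hfib z hz) hzS
    linarith

variable {α : ℝ} {θ : ℕ → ℝ} {O : Set (GaugeField (F.P J) 0 (Matrix.specialUnitaryGroup (Fin 2) ℂ))}

/-- ★★ **EXW ∕ GAP♯ ⇒ LIMIT-INST's `hO0 hmin ha0 hg hg0 hgpos hgrow` — CHART-DATA EDITION.**  Data: the WREG chart data `D` on `histGood θ` (pivots of small
histories charted: `hθ0`, `hθα`); a window datum `V`; EXW's minimiser `U₀` over `V` (`U₀ ∈ fibre V ∩ histGood`, `wilsonAction4 U₀ = m`); GAP♯'s conclusion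
at the datum with constant `μ′ > 0`; a carrier `Xc` inside the charted window graph of `V` on which `z ↦ D.Φ (V, z)` is continuous (CHART∞'s row).
Conclusion: the seven rows for `D.Φ ∕ D.jac` (`= (WindowChart.ofChartData D …).Φ ∕ .jac` by `rfl`), `Sf := histGood`, `σ 0 := U₀` — §1's self-recognition,
fibre row and off-pivot agreement fed to `limitInst_exw_gap_rows_of_chartRows`.
[cite: Balaban1985Variational, Thm 1 (8)-(10) p.279 and (142) p.299; Balaban1987RG1, (0.4) p.253 and (2.10) p.267; Balaban1985UV3, (7) p.257] -/
theorem limitInst_exw_gap_rows (D : ChartData F hJK α (histGood F ℰp θ K J) O) (hθ0 : ∀ i, 0 ≤ θ i)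
    (hθα : ∀ i, (((((F.P K).d + 2) * (F.P K).L : ℕ) : ℝ) ^ 2 / 4) * θ i ≤ α)
    {V : GaugeField (F.P J) 0 (Matrix.specialUnitaryGroup (Fin 2) ℂ)} {m μ' : ℝ} (hμ' : 0 < μ')
    {U₀ : GaugeField (F.P K) 0 (Matrix.specialUnitaryGroup (Fin 2) ℂ)}
    (hU₀f : U₀ ∈ fibre F ℰp J K hJK V) (hU₀h : U₀ ∈ histGood F ℰp θ K J) (hU₀m : wilsonAction4 U₀ = m)
    (hgap : ∀ U ∈ fibre F ℰp J K hJK V, U ∈ histGood F ℰp θ K J →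
      μ' * ⨅ w : {w : Site (F.P K) 0 → Matrix.specialUnitaryGroup (Fin 2) ℂ |
              ∀ U : GaugeField (F.P K) 0 (Matrix.specialUnitaryGroup (Fin 2) ℂ),
                descendTo F ℰp J K hJK (GaugeField.gaugeAct w U) = descendTo F ℰp J K hJK U},
            ∑ ℓ : PBond (F.P K) 0,
              dist1 (U ℓ * ((GaugeField.gaugeAct (w : Site (F.P K) 0 → Matrix.specialUnitaryGroup (Fin 2) ℂ) U₀) ℓ)⁻¹) ^ 2 ≤ wilsonAction4 U - m)
    {Xc : Set (GaugeField (F.P K) 0 (Matrix.specialUnitaryGroup (Fin 2) ℂ))} (hXc : Xc ⊆ {z | ∀ c, V (D.w c) ∈ D.T c z})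
    (hΦc : ContinuousOn (fun z => D.Φ (V, z)) Xc) :
    D.Φ (V, U₀) ∈ histGood F ℰp θ K J ∧ wilsonAction4 (D.Φ (V, U₀)) = m ∧ 0 < (D.jac (V, U₀) : ℝ) ∧
      ContinuousOn (fun z => μ' * ⨅ w : {w : Site (F.P K) 0 → Matrix.specialUnitaryGroup (Fin 2) ℂ |
              ∀ U : GaugeField (F.P K) 0 (Matrix.specialUnitaryGroup (Fin 2) ℂ),
                descendTo F ℰp J K hJK (GaugeField.gaugeAct w U) = descendTo F ℰp J K hJK U},
            ∑ ℓ : PBond (F.P K) 0,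
              dist1 (D.Φ (V, z) ℓ * ((GaugeField.gaugeAct (w : Site (F.P K) 0 → Matrix.specialUnitaryGroup (Fin 2) ℂ) U₀) ℓ)⁻¹) ^ 2) Xc ∧
      (∀ z ∈ Xc, 0 ≤ μ' * ⨅ w : {w : Site (F.P K) 0 → Matrix.specialUnitaryGroup (Fin 2) ℂ |
              ∀ U : GaugeField (F.P K) 0 (Matrix.specialUnitaryGroup (Fin 2) ℂ),
                descendTo F ℰp J K hJK (GaugeField.gaugeAct w U) = descendTo F ℰp J K hJK U},
            ∑ ℓ : PBond (F.P K) 0,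
              dist1 (D.Φ (V, z) ℓ * ((GaugeField.gaugeAct (w : Site (F.P K) 0 → Matrix.specialUnitaryGroup (Fin 2) ℂ) U₀) ℓ)⁻¹) ^ 2) ∧
      (∀ z ∈ Xc, (∀ k : ↥(residualSubgroup F hJK) × (PBond (F.P K) (K - J) → Matrix.specialUnitaryGroup (Fin 2) ℂ),
          pivotAct F hJK (iterCentralBond (P := F.P K) (K - J)) k U₀ ≠ z) →
        0 < μ' * ⨅ w : {w : Site (F.P K) 0 → Matrix.specialUnitaryGroup (Fin 2) ℂ |
              ∀ U : GaugeField (F.P K) 0 (Matrix.specialUnitaryGroup (Fin 2) ℂ),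
                descendTo F ℰp J K hJK (GaugeField.gaugeAct w U) = descendTo F ℰp J K hJK U},
            ∑ ℓ : PBond (F.P K) 0,
              dist1 (D.Φ (V, z) ℓ * ((GaugeField.gaugeAct (w : Site (F.P K) 0 → Matrix.specialUnitaryGroup (Fin 2) ℂ) U₀) ℓ)⁻¹) ^ 2) ∧
      (∀ z ∈ Xc, D.Φ (V, z) ∈ histGood F ℰp θ K J →
        m + μ' * ⨅ w : {w : Site (F.P K) 0 → Matrix.specialUnitaryGroup (Fin 2) ℂ |
              ∀ U : GaugeField (F.P K) 0 (Matrix.specialUnitaryGroup (Fin 2) ℂ),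
                descendTo F ℰp J K hJK (GaugeField.gaugeAct w U) = descendTo F ℰp J K hJK U},
            ∑ ℓ : PBond (F.P K) 0,
              dist1 (D.Φ (V, z) ℓ * ((GaugeField.gaugeAct (w : Site (F.P K) 0 → Matrix.specialUnitaryGroup (Fin 2) ℂ) U₀) ℓ)⁻¹) ^ 2
          ≤ wilsonAction4 (D.Φ (V, z))) :=
  limitInst_exw_gap_rows_of_chartRows F hJK D.Φ D.jac hμ' hU₀h hU₀m (jac_ne_zero_and_Φ_eq_self D hθ0 hθα hU₀f hU₀h) hgap
    (fun _ hz b hb => (D.charted V _ (hXc hz)).1 b hb) (fun _ hz => descendTo_Φ_of_charted D (hXc hz)) hΦc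

end Rows

end Summit.QuantumFields.YangMills.Theorems.FluctuationComparisonRegPrIntLS2BetaFibreTransport

end
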